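import Summits.AtomisticToContinuum.FouriersLaw.Theorems.OddSectorIrreversibilityTapLeakBoundSplitGlue
import Summits.AtomisticToContinuum.FouriersLaw.Theorems.ClosedConeSensitivity.Negative.ZeroFrictionDictionary
import Summits.AtomisticToContinuum.FouriersLaw.Theorems.OddSectorIrreversibilitySubBallisticWindowCoboundaryCeiling
import Summits.AtomisticToContinuum.FouriersLaw.Theorems.OddSectorIrreversibilitySubBallisticWindowGibbsMoments
import Summits.AtomisticToContinuum.FouriersLaw.Theorems.OddSectorIrreversibilitySubBallisticWindowGibbsPoincare
import Summits.AtomisticToContinuum.FouriersLaw.Theorems.OddSectorIrreversibilitySubBallisticWindowStaticCurrentBound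

/-!
# `TapLeakBound` (stmt-AtomisticToContinuum-15159), line `SketchIdeator2`: the a-priori CAP of the kick cone

Helper file (`--supports stmt-AtomisticToContinuum-15159`) for crux
P = `Summit.AtomisticToContinuum.FouriersLaw.Theses.OddSectorIrreversibility.TapLeakBound`, registered stub
`stub_kickCone` (= C′ `ResampledKickCone`, the `N`-uniform flow-side child). This file does NOT prove the stub
(its `(1 + d - s/a)^{-3}` decay inside a linear window is an open `N`-uniform propagation estimate for the closed
pinned FPU-β chain; no published light-cone theorem covers unbounded quartic interactions on linear rays); it
lands the part that IS provable now, uniformly in `N`, `i`, `b`, `s ≥ 0`: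

* `integral_resampleDiff_sq_le` — for `g ∈ L²(μ_T)` and any coordinate `b`,
  `∫∫ (g(q, p[b ↦ p']) - g(q,p))² dN(0,T)(p') dμ_T ≤ 4 ∫ g² dμ_T` (`(x-y)² ≤ 2x² + 2y²` and the
  measure-preserving resampling involution of `stub_resamplePreserving`);
* `kickCone_capped_core` / `kickCone_capped` — **the CAP**: with `g = j_i ∘ Φ_s` (`Φ_s = detFlow`, the
  zero-friction kernels of the stub), `∫∫ (g∘σ - g)² dN(0,T) dμ_T ≤ C₀ · Z` with
  `C₀ = 16 T (1 + (1 + 16β²) C₃)`, `C₃` the `N`-uniform sixth position moment constant of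
  `SubBallisticWindow.GibbsMoments.stub_gibbsMoments` (+ `GibbsPoincare.stub_gibbsPoincare`): invariance of
  `μ_T` under `Φ_s` (`CoboundaryCeiling.integral_comp_detFlow_gibbsWeight`) and the local Gibbs moment
  `∫ j_i² dμ_T ≤ 4T(1 + (1 + 16β²)C₃) Z` (`StaticCurrentBound.integral_sq_bondCurrent_le`);
* `kickCone_of_bounded_shell` — consequently the stub's inequality holds, with constant `C₀ M`, at every
  `(N, i, b, s)` of its window where `(1 + d - s/a)^3 ≤ M` (the outer shell of the cone); the open content
  of `stub_kickCone` is exactly the complementary deep interior `d - s/a → ∞`.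

References: folklore (Liouville invariance, Gaussian resampling); the missing decay would be a classical
Lieb–Robinson-type bound — Marchioro–Pellegrinotti–Pulvirenti–Triolo 1978 (bounded forces, linear cone),
Buttà–Caglioti–Di Ruzza–Marchioro 2007 Thm 2.2 (quartic pinning, harmonic or pinning-dominated coupling,
a.s. tangent bound on `|i-j| > t log^α t` only), Raz–Sims 2009 Thm 2 (bounded perturbations) do not cover it.
-/

noncomputable section

open MeasureTheory ProbabilityTheory Filter Topology Set Function
open scoped NNReal ENNReal ContDiff

namespace Summit.AtomisticToContinuum.FouriersLaw.Theorems.OddSectorIrreversibility.TapLeak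

open Literature.MathematicalPhysics.KineticTheory.HeatConduction
open Literature.MathematicalPhysics.KineticTheory
open Summit.AtomisticToContinuum.FouriersLaw.Theses.OddSectorIrreversibility (TapLeakBound)
open Summit.AtomisticToContinuum.FouriersLaw.Theorems.ClosedConeSensitivity.Negative.ZeroFrictionDictionary
open Summit.AtomisticToContinuum.FouriersLaw.Theorems.OddSectorWitness
open Summit.AtomisticToContinuum.FouriersLaw.Theorems.OddSectorIrreversibility.Corrector

/-- **Resampled differences are capped by the second moment.** For `g ∈ L²(μ_T)` and any coordinate `b`:
`∫∫ (g(q, p[b ↦ p']) - g(q,p))² dN(0,T)(p') dμ_T ≤ 4 ∫ g² dμ_T`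
(`(x - y)² ≤ 2x² + 2y²`; the resampling involution `S` of `stub_resamplePreserving` preserves `μ_T ⊗ N(0,T)`,
and the first marginal of `μ_T ⊗ N(0,T)` is `μ_T`). [folklore] -/
theorem integral_resampleDiff_sq_le (ω₂ lam β γ : ℝ) {T : ℝ} (hT : 0 < T) {N : ℕ} (b : Fin N)
    {g : PhaseSpace N → ℝ} (hg : MemLp g 2 (gibbsWeight ω₂ lam β γ N T)) :
    ∫ x, (∫ p', (g (x.1, Function.update x.2 b p') - g x) ^ 2 ∂(gaussianReal 0 (Real.toNNReal T)))
        ∂(gibbsWeight ω₂ lam β γ N T) ≤ 4 * ∫ x, (g x) ^ 2 ∂(gibbsWeight ω₂ lam β γ N T) := by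
  set μ := gibbsWeight ω₂ lam β γ N T with hμ
  set γT : Measure ℝ := gaussianReal 0 (Real.toNNReal T) with hγT
  haveI : SFinite μ := by rw [hμ]; unfold gibbsWeight; infer_instance
  haveI : IsProbabilityMeasure γT := by rw [hγT]; infer_instance
  set ν : Measure (PhaseSpace N × ℝ) := μ.prod γT with hν
  set S : PhaseSpace N × ℝ → PhaseSpace N × ℝ :=
    fun z => ((((z.1.1, Function.update z.1.2 b z.2)) : PhaseSpace N), z.1.2 b) with hS
  have hSp : MeasurePreserving S ν ν := stub_resamplePreserving ω₂ lam β γ hT b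
  have hSS : ∀ z, S (S z) = z := by rintro ⟨⟨q, p⟩, t⟩; simp [hS]
  have hSc : Continuous S := by simp only [hS]; fun_prop
  have hSm : Measurable S := hSc.measurable
  let e : PhaseSpace N × ℝ ≃ᵐ PhaseSpace N × ℝ :=
    { toFun := S, invFun := S, left_inv := hSS, right_inv := hSS,
      measurable_toFun := hSm, measurable_invFun := hSm }
  have hSe : MeasurableEmbedding S := e.measurableEmbedding
  set G₁ : PhaseSpace N × ℝ → ℝ := fun z => g z.1 with hG₁
  set G₂ : PhaseSpace N × ℝ → ℝ := fun z => g (z.1.1, Function.update z.1.2 b z.2) with hG₂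
  have hG12 : MemLp G₁ 2 ν := hg.comp_fst γT
  have hG22 : MemLp G₂ 2 ν := memLp_resample ω₂ lam β γ hT b hg
  have hfst : ∀ F : PhaseSpace N → ℝ, ∫ z, F z.1 ∂ν = ∫ x, F x ∂μ := fun F => by
    rw [hν, integral_fun_fst, probReal_univ, one_smul]
  have hI1 : Integrable (fun z => (G₁ z) ^ 2) ν := hG12.integrable_sq
  have hI2 : Integrable (fun z => (G₂ z) ^ 2) ν := hG22.integrable_sq
  have h1 : ∫ z, (G₁ z) ^ 2 ∂ν = ∫ x, (g x) ^ 2 ∂μ := hfst (fun x => (g x) ^ 2)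
  have h2 : ∫ z, (G₂ z) ^ 2 ∂ν = ∫ x, (g x) ^ 2 ∂μ :=
    (hSp.integral_comp hSe (fun w => (g w.1) ^ 2)).trans (hfst (fun x => (g x) ^ 2))
  have hVsq : ∫ z, ((G₁ - G₂) z) ^ 2 ∂ν =
      ∫ x, (∫ p', (g (x.1, Function.update x.2 b p') - g x) ^ 2 ∂γT) ∂μ := by
    have hint : Integrable (fun z => ((G₁ - G₂) z) ^ 2) ν := (hG12.sub hG22).integrable_sq
    rw [hν, integral_prod _ hint]
    refine integral_congr_ae (Eventually.of_forall fun x => integral_congr_ae (Eventually.of_forall fun p' => ?_))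
    simp only [hG₁, hG₂, Pi.sub_apply]
    ring
  have hR : Integrable (fun z => 2 * (G₁ z) ^ 2 + 2 * (G₂ z) ^ 2) ν := (hI1.const_mul 2).add (hI2.const_mul 2)
  rw [← hVsq]
  calc ∫ z, ((G₁ - G₂) z) ^ 2 ∂ν ≤ ∫ z, (2 * (G₁ z) ^ 2 + 2 * (G₂ z) ^ 2) ∂ν := by
        refine integral_mono ((hG12.sub hG22).integrable_sq) hR fun z => ?_
        simp only [Pi.sub_apply]
        nlinarith [sq_nonneg (G₁ z + G₂ z)]
    _ = 2 * ∫ z, (G₁ z) ^ 2 ∂ν + 2 * ∫ z, (G₂ z) ^ 2 ∂ν := by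
        rw [integral_add (hI1.const_mul 2) (hI2.const_mul 2), integral_const_mul, integral_const_mul]
    _ = 4 * ∫ x, (g x) ^ 2 ∂μ := by rw [h1, h2]; ring

section Capped

variable {ω₂ lam β : ℝ} (hω : 0 < ω₂) (hl : 0 ≤ lam) (hβ : 0 ≤ β) (γ : ℝ) {T : ℝ} (hT : 0 < T)
include hω hl hβ hT

/-- **The cap, core form.** For `g = j_i ∘ Φ_s` (`s ≥ 0`, any bond `i`, any coordinate `b`), given sixth position
moments `∫ q_k⁶ e^{-H/T} ≤ C₃ Z` for all sites `k`:
`∫∫ (g(q, p[b ↦ p']) - g(q,p))² dN(0,T)(p') dμ_T ≤ 16 T (1 + (1 + 16β²) C₃) · Z`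
(`integral_resampleDiff_sq_le`, invariance of `μ_T` under `Φ_s`, `∫ j_i² dμ_T ≤ 4T(1 + (1+16β²)C₃) Z`). [folklore] -/
theorem kickCone_capped_core {N : ℕ} (i b : Fin N) {s : ℝ} (hs : 0 ≤ s) {C₃ : ℝ} (hC₃ : 0 ≤ C₃)
    (hq6 : ∀ k : Fin N, ∫ x, x.1 k ^ 6 * (pinnedChain ω₂ lam β γ).gibbsDensity N T x ≤
      C₃ * ∫ x, (pinnedChain ω₂ lam β γ).gibbsDensity N T x) :
    ∫ x, (∫ p', ((pinnedChain ω₂ lam β γ).bondCurrent N i (detFlow ω₂ lam β N s (x.1, Function.update x.2 b p')) -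
        (pinnedChain ω₂ lam β γ).bondCurrent N i (detFlow ω₂ lam β N s x)) ^ 2 ∂(gaussianReal 0 (Real.toNNReal T)))
        ∂(gibbsWeight ω₂ lam β γ N T) ≤
      16 * T * (1 + (1 + 16 * β ^ 2) * C₃) * ∫ x, (pinnedChain ω₂ lam β γ).gibbsDensity N T x := by
  set g : PhaseSpace N → ℝ := fun y => (pinnedChain ω₂ lam β γ).bondCurrent N i (detFlow ω₂ lam β N s y) with hg
  have hgc : Continuous g :=
    (pinnedChain_continuous_bondCurrent ω₂ lam β γ N i).comp (continuous_detFlow hω hl hβ N s)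
  have hg2 : MemLp g 2 (gibbsWeight ω₂ lam β γ N T) := by
    refine memLp_two_of_abs_le_pow hω hl hβ γ N hT hgc.aestronglyMeasurable (N * ((3 + β) / 2)) 2 fun y => ?_
    have h := abs_bondCurrent_detFlow_le hω hl hβ N γ i s y
    simpa only [hg, mul_assoc] using h
  have hcap := integral_resampleDiff_sq_le ω₂ lam β γ hT b hg2
  have hinv : ∫ x, (g x) ^ 2 ∂(gibbsWeight ω₂ lam β γ N T) =
      ∫ x, ((pinnedChain ω₂ lam β γ).bondCurrent N i x) ^ 2 ∂(gibbsWeight ω₂ lam β γ N T) :=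
    SubBallisticWindow.CoboundaryCeiling.integral_comp_detFlow_gibbsWeight hω hl hβ γ N T hs
      (g := fun x => ((pinnedChain ω₂ lam β γ).bondCurrent N i x) ^ 2)
      ((pinnedChain_continuous_bondCurrent ω₂ lam β γ N i).pow 2).aestronglyMeasurable
  have hjj := SubBallisticWindow.StaticCurrentBound.integral_sq_bondCurrent_le hω hl hβ γ N hT hC₃ hq6 i
  have hjj' : ∫ x, ((pinnedChain ω₂ lam β γ).bondCurrent N i x) ^ 2 ∂(gibbsWeight ω₂ lam β γ N T) ≤
      4 * T * (1 + (1 + 16 * β ^ 2) * C₃) * ∫ x, (pinnedChain ω₂ lam β γ).gibbsDensity N T x := by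
    unfold gibbsWeight
    rw [SubBallisticWindow.StaticCurrentBound.integral_gibbsWeight_eq]
    exact hjj
  have key : 4 * ∫ x, (g x) ^ 2 ∂(gibbsWeight ω₂ lam β γ N T) ≤
      4 * (4 * T * (1 + (1 + 16 * β ^ 2) * C₃) * ∫ x, (pinnedChain ω₂ lam β γ).gibbsDensity N T x) := by
    rw [hinv]
    exact mul_le_mul_of_nonneg_left hjj' (by norm_num)
  have e : 4 * (4 * T * (1 + (1 + 16 * β ^ 2) * C₃) * ∫ x, (pinnedChain ω₂ lam β γ).gibbsDensity N T x) =
      16 * T * (1 + (1 + 16 * β ^ 2) * C₃) * ∫ x, (pinnedChain ω₂ lam β γ).gibbsDensity N T x := by ring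
  exact (hcap.trans key).trans_eq e

end Capped

/-- **The cap (`N`-uniform, the provable part of `stub_kickCone`).** In the stub's own spelling with its `let`s
unfolded (`μ_T` as `withDensity`, `j_i ∘ Φ_s` as the zero-friction kernel integral `js`, `Z = ∫ e^{-H/T}`): there is
`C = C(ω₂, lam, β, T) ≥ 0` such that for EVERY `N`, bond `i`, coordinate `b`, `s ≥ 0`,
`∫∫ (js(q, p[b ↦ p']) - js(q,p))² dN(0,T)(p') dμ_T ≤ C · Z` — the stub's inequality WITHOUT the
`(1 + d - s/a)^{-3}` decay (no window, no contact hypothesis needed). [folklore] -/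
theorem kickCone_capped : ∀ ω₂ lam β γ : ℝ, 0 < ω₂ → 0 ≤ lam → 0 ≤ β → ∀ T : ℝ, 0 < T →
    ∃ C : ℝ, 0 ≤ C ∧ ∀ (N : ℕ) (i b : Fin N) (s : ℝ), 0 ≤ s →
      ∫ x, (∫ p', ((∫ y, (pinnedChain ω₂ lam β γ).bondCurrent N i y
            ∂((pinnedChain ω₂ lam β 0).transitionKernel N T T s.toNNReal (x.1, Function.update x.2 b p'))) -
          (∫ y, (pinnedChain ω₂ lam β γ).bondCurrent N i y
            ∂((pinnedChain ω₂ lam β 0).transitionKernel N T T s.toNNReal x))) ^ 2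
          ∂(gaussianReal 0 (Real.toNNReal T)))
        ∂(volume.withDensity (fun x : PhaseSpace N =>
            ENNReal.ofReal (Real.exp (-((pinnedChain ω₂ lam β γ).hamiltonian N x) / T))))
        ≤ C * (∫ x : PhaseSpace N, Real.exp (-((pinnedChain ω₂ lam β γ).hamiltonian N x) / T) ∂volume) := by
  intro ω₂ lam β γ hω hl hβ T hT
  obtain ⟨C₃, hC₃⟩ := SubBallisticWindow.GibbsMoments.stub_gibbsMoments ω₂ lam β γ hω hl hβ T hT
    (SubBallisticWindow.GibbsPoincare.stub_gibbsPoincare ω₂ lam β γ hω hl hβ T hT) 3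
  refine ⟨16 * T * (1 + (1 + 16 * β ^ 2) * max C₃ 0), by positivity, fun N i b s hs => ?_⟩
  have hjs : ∀ x : PhaseSpace N, ∫ y, (pinnedChain ω₂ lam β γ).bondCurrent N i y
      ∂((pinnedChain ω₂ lam β 0).transitionKernel N T T s.toNNReal x) =
      (pinnedChain ω₂ lam β γ).bondCurrent N i (detFlow ω₂ lam β N s x) := fun x => by
    rw [integral_transitionKernel_zero_friction hω hl hβ, Real.coe_toNNReal s hs]
  simp only [hjs]
  have hZ0 : 0 ≤ ∫ x : PhaseSpace N, Real.exp (-((pinnedChain ω₂ lam β γ).hamiltonian N x) / T) :=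
    integral_nonneg fun x => (Real.exp_pos _).le
  have hq6 : ∀ k : Fin N, ∫ x, x.1 k ^ 6 * (pinnedChain ω₂ lam β γ).gibbsDensity N T x ≤
      max C₃ 0 * ∫ x : PhaseSpace N, Real.exp (-((pinnedChain ω₂ lam β γ).hamiltonian N x) / T) := by
    intro k
    have h := (hC₃ N k).1
    rw [SubBallisticWindow.StaticCurrentBound.integral_gibbsWeight_eq] at h
    simp only [Nat.reduceMul] at h
    exact h.trans (mul_le_mul_of_nonneg_right (le_max_left _ _) hZ0)
  exact kickCone_capped_core hω hl hβ γ hT i b hs (le_max_right _ _) hq6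

/-- **The outer shell of the cone is settled by the cap.** With the constant `C` of `kickCone_capped` and ANY
`a > 0`, `M ≥ 0`: at every point of the stub's window `0 ≤ s ≤ a·d` where `(1 + (d - s/a))^3 ≤ M`, the stub's
inequality holds with constant `C·M` — so the open content of `stub_kickCone` is the decay deep inside the cone
(`d - s/a → ∞`), an `N`-uniform linear-window propagation bound for the closed pinned FPU-β flow. [folklore] -/
theorem kickCone_of_bounded_shell : ∀ ω₂ lam β γ : ℝ, 0 < ω₂ → 0 ≤ lam → 0 ≤ β → ∀ T : ℝ, 0 < T →
    ∃ C : ℝ, 0 ≤ C ∧ ∀ (a M : ℝ), 0 < a → ∀ (N : ℕ) (i b : Fin N) (s : ℝ), 0 ≤ s →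
      let P := pinnedChain ω₂ lam β γ
      let P₀ := pinnedChain ω₂ lam β 0
      let μT : Measure (PhaseSpace N) :=
        volume.withDensity (fun x : PhaseSpace N => ENNReal.ofReal (Real.exp (-(P.hamiltonian N x) / T)))
      let js : PhaseSpace N → ℝ := fun x => ∫ y, P.bondCurrent N i y ∂(P₀.transitionKernel N T T s.toNNReal x)
      let d : ℕ := if b.val = 0 then i.val else N - 2 - i.val
      s ≤ a * (d : ℝ) → (1 + ((d : ℝ) - s / a)) ^ 3 ≤ M →
        ∫ x, (∫ p', (js (x.1, Function.update x.2 b p') - js x) ^ 2 ∂(gaussianReal 0 (Real.toNNReal T))) ∂μT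
          ≤ C * M * (∫ x, Real.exp (-(P.hamiltonian N x) / T) ∂volume) / (1 + ((d : ℝ) - s / a)) ^ 3 := by
  intro ω₂ lam β γ hω hl hβ T hT
  obtain ⟨C, hC0, hC⟩ := kickCone_capped ω₂ lam β γ hω hl hβ T hT
  refine ⟨C, hC0, fun a M ha N i b s hs => ?_⟩
  dsimp only
  intro hsd hM
  refine (hC N i b s hs).trans ?_
  set Z : ℝ := ∫ x : PhaseSpace N, Real.exp (-((pinnedChain ω₂ lam β γ).hamiltonian N x) / T) with hZ
  set D : ℝ := 1 + (((if b.val = 0 then i.val else N - 2 - i.val : ℕ) : ℝ) - s / a) with hD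
  have hZ0 : 0 ≤ Z := integral_nonneg fun x => (Real.exp_pos _).le
  have hD1 : 1 ≤ D := by
    have : s / a ≤ ((if b.val = 0 then i.val else N - 2 - i.val : ℕ) : ℝ) := by
      rw [div_le_iff₀ ha]; linarith [mul_comm a (((if b.val = 0 then i.val else N - 2 - i.val : ℕ) : ℝ))]
    rw [hD]; linarith
  have hD0 : 0 < D ^ 3 := by positivity
  rw [le_div_iff₀ hD0]
  calc C * Z * D ^ 3 ≤ C * Z * M := mul_le_mul_of_nonneg_left hM (mul_nonneg hC0 hZ0)
    _ = C * M * Z := by ring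

end Summit.AtomisticToContinuum.FouriersLaw.Theorems.OddSectorIrreversibility.TapLeak

end
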